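import Summits.QuantumFields.YangMills.Theorems.BalabanUVNodesN08AlphaProfileLarge
import Summits.QuantumFields.YangMills.Theorems.BalabanUVNodesN08AlphaCompactEnd
import Summits.QuantumFields.YangMills.Theorems.BalabanUVNodesN08AlphaB7AllScales

/-!
# Route «BalabanUVNodes», Track-A DAG node N08 = [Balaban1985UV3] — (α) clause: THE END OVER THE CONSTRUCTED PROFILES —
# `InEdgeFaces₃` and `RunAlpha` from the DATA schema, (b7) on [7]'s class, and STRUCTURAL hypotheses only

Cell `pub-ymgap`, seat `pub-ymgap-dag-n08-d` gen 5, file F7 (over F5d `…ProfileLarge` and gen 4's `…CompactSel` ∕ `…CompactEnd`).  `bears_on: R4∕N08`; filed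
`--supports stmt-QuantumFields-19910 --as helper`.  Sorry-free, standard axioms.

WHAT CHANGES RELATIVE TO GEN 4.  Gen 4's END (`…CompactEnd.exists_externalInputs_runAlpha_of_nonempty`, `…Profile.exists_externalInputs_runAlpha_of_profile`)
displayed (b11′)∕(b11″)∕(b11‴) — the existence of regular `h`-large data ∕ profiles.  F5d proves (b11‴) for ADMISSIBLE histories of `k ≤ K` steps; the faces
only read those.  So here:
* §1 `exists_externalInputs_faces₃_restricted` — gen 4's file-6 selection theorem with its hypotheses restricted to what the faces read: (b7) `hcont` for
  `k ≤ K` only, the `h`-largeness of the data for `k ≤ K` and ADMISSIBLE `h` only (the constraint family is taken empty beyond `K`, selector `≡ 1` there);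
* §2 ★ `exists_externalInputs_faces₃_of_structure` ∕ ★ `exists_externalInputs_runAlpha_of_structure`: with the data := the lifted averages of F5's profiles,
  the top clause dropped (`Sm = ∅`), the objective a Wilson action and the standard averaging, the constraint spaces contain the profiles themselves, so
  `InEdgeFaces₃ 𝔊 (regMin 𝔠) X` and — with the DATA schema on the N08 family — `RunAlpha 𝔊 𝔠 X` hold for external inputs that EXIST, from:
  (b7) `hcont` on [7]'s class (displayed, `k ≤ K`), and the STRUCTURAL hypotheses `X ∈ 𝔤 ∖ 0`, `min C68 (2L²B₃) ≥ 4π`, `min C68 (2L²B₃)·g_jp(g_j) ≤ ¼` and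
  `⌈R₁r(g_j)⌉M₁ ≥ 14` (`j < K`).  The in-edge hypothesis (b11‴) of gen 4 is GONE.
* §3 ★★ `exists_externalInputs_runAlpha_of_structure_window`: with F6 (`…B7AllScales.hcont_regClass`, [4] Prop. 2 with its printed locality) the displayed
  (b7) is DISCHARGED too under [4]'s window (`C₀α₀ ≤ ⅓`, `2α₀ ≤ c₂′`, `512(d+1)(d+4)L²(α₀+2C₀α₀²) ≤ 1`, `α₀ = min C68 (2L²B₃)·g_jp(g_j)`, `j < K`): THE IN-EDGE SIDE OF
  THE (α) CLAUSE IS EMPTY — `RunAlpha` for external inputs that exist follows from the DATA schema (classes II + III, the cluster expansion of [B10]) and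
  STRUCTURAL hypotheses on the constants and the group alone.
HONEST FRAMING: nothing of [B10]'s cluster expansion (the DATA schema `RunDataRows`) is asserted; count-neutral; NOT a discharge of N08.  d = 3 lattice gauge theory on finite tori as printed; nothing about
d = 4, the continuum, OS axioms, a mass gap or the Clay problem.
-/

noncomputable section

namespace Summit.QuantumFields.YangMills.Theorems.BalabanUVNodesN08AlphaProfileEnd

open MeasureTheory Set Topology TopologicalSpace
open scoped Matrix Matrix.Norms.L2Operator
open Literature.MathematicalPhysics.QuantumFieldTheory.Balaban1983to89
open Literature.MathematicalPhysics.QuantumFieldTheory.Balaban1983to89.B10 (pFun)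
open Literature.MathematicalPhysics.QuantumFieldTheory.Balaban1983to89.B10SectCExpansion (TermSizes)
open Literature.MathematicalPhysics.QuantumFieldTheory.Balaban1985CMP102
open Literature.MathematicalPhysics.QuantumFieldTheory.Balaban1985CMP102.Setting
open Summit.QuantumFields.Balaban3D.Carriers
open Summit.QuantumFields.Balaban3D.Proofs.Inputs
open Summit.QuantumFields.Balaban3D.Proofs.Primitives (AlphaConsts)
open Summit.QuantumFields.Balaban3D.Proofs.GroupModelLieC (lieC)
open Summit.QuantumFields.Balaban3D.Proofs.UVStability3DInputs
open Summit.QuantumFields.Balaban3D.Proofs.LiftBridge (liftCfg)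
open Summit.QuantumFields.Balaban3D.Proofs.TorusLift (projSite)
open Summit.QuantumFields.YangMills.Theorems.BalabanUVNodesN08AlphaClassI
open Summit.QuantumFields.YangMills.Theorems.BalabanUVNodesN08AlphaLoop28
open Summit.QuantumFields.YangMills.Theorems.BalabanUVNodesN08AlphaThreeFaces (regMin gammaN08 runAlpha_of_data_faces₃_of_le)
open Summit.QuantumFields.YangMills.Theorems.BalabanUVNodesN08AlphaGroupTopology
open Summit.QuantumFields.YangMills.Theorems.BalabanUVNodesN08AlphaRegSel
open Summit.QuantumFields.YangMills.Theorems.BalabanUVNodesN08AlphaInB42Sel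
open Summit.QuantumFields.YangMills.Theorems.BalabanUVNodesN08AlphaCompactSel
open Summit.QuantumFields.YangMills.Theorems.BalabanUVNodesN08AlphaProfileBuild
open Summit.QuantumFields.YangMills.Theorems.BalabanUVNodesN08AlphaProfileRegular
open Summit.QuantumFields.YangMills.Theorems.BalabanUVNodesN08AlphaProfileLarge
open Summit.QuantumFields.YangMills.Theorems.BalabanUVNodesN08AlphaB7AllScales (hcont_regClass)
open B7Prop2Explicit (C0 c2')
open B7Prop1Explicit (e)
open B7Prop2Explicit (avgIter)

variable {L : ℕ} {S : Scales L} {G : Type} [GaugeGroup G] [MeasurableSpace G] [HaarData G] (𝔊 : GroupModel G) (𝔠 : AlphaConsts L 𝔊.N)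

/-! ## §1 Gen 4's selection with the hypotheses restricted to what the faces read -/

/-- **`InEdgeFaces₃` FROM (b7) ON THE RUN'S SCALES AND NON-EMPTINESS**: as `…CompactSel.exists_externalInputs_faces₃_of_nonempty`, but with (b7) `hcont` asked
for `k ≤ K` only and the `h`-largeness of the data asked for `k ≤ K` and ADMISSIBLE `h` only (the constraint family is empty beyond `K`, where the selector is
`≡ 1`; the faces never read those steps). [cite: Balaban1985UV3, (42) p.266 + (67)–(68) p.273; Balaban1985Variational, (2)+(3)+(8) pp.278–279, Thm 1 p.279] -/
theorem exists_externalInputs_faces₃_restricted (X₀ : ExternalInputs S G) {A : GaugeField S.P 0 G → ℝ}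
    (hA : letI := rhoTopology 𝔊; Continuous A)
    (Vl : (k : ℕ) → Hist S.P k → ℕ → B7Prop1Explicit.Site S.P.d → Fin S.P.d → (Matrix (Fin 𝔊.N) (Fin 𝔊.N) ℂ)ˣ)
    (hVl : ∀ k, k ≤ S.K → ∀ (h : Hist S.P k), Hist.Admissible 𝔠.lane.carrier.M₁ (rcolOf S 𝔠.lane.carrier) k h →
      HLarge S 𝔠.lane.carrier.b₀ 𝔠.lane.carrier.p₀ h (Vl k h))
    (Sm : (k : ℕ) → Hist S.P k → Set (GaugeField S.P k G)) (hSm : letI := rhoTopology 𝔊; ∀ k h, IsOpen (Sm k h))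
    (T : (k : ℕ) → GaugeField S.P 0 G → GaugeField S.P k G) (Bk : (k : ℕ) → Hist S.P k → Set (PBond S.P k))
    (hcont : letI := rhoTopology 𝔊; ∀ (k : ℕ), k ≤ S.K → ∀ (h : Hist S.P k), ∀ j < k, ∀ (z : B7Prop1Explicit.Site S.P.d) (κ : Fin S.P.d),
      projSite (((L : ℤ) ^ j) • z) ∈ Lam 𝔠.lane.carrier.M₁ (rcolOf S 𝔠.lane.carrier) h j →
      projSite (((L : ℤ) ^ j) • (z + e κ)) ∈ Lam 𝔠.lane.carrier.M₁ (rcolOf S 𝔠.lane.carrier) h j →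
      ContinuousOn (fun U : GaugeField S.P 0 G => ((avgIter L (liftCfg 𝔊 U) j z κ : (Matrix (Fin 𝔊.N) (Fin 𝔊.N) ℂ)ˣ) :
        Matrix (Fin 𝔊.N) (Fin 𝔊.N) ℂ)) (regClass 𝔊 𝔠 k h))
    (hT : letI := rhoTopology 𝔊; ∀ (k : ℕ) (h : Hist S.P k), ContinuousOn (T k) (regClass 𝔊 𝔠 k h))
    (hne : ∀ k, k ≤ S.K → ∀ (h : Hist S.P k), Hist.Admissible 𝔠.lane.carrier.M₁ (rcolOf S 𝔠.lane.carrier) k h →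
      ∀ (V : GaugeField S.P k G), (admB42c 𝔊 𝔠 k h (Vl k h) (Sm k h) (T k) (Bk k h) V).Nonempty) :
    ∃ X : ExternalInputs S G, X.av = X₀.av ∧ X.reg = X₀.reg ∧ (∀ (k : ℕ) (h : Hist S.P k), Measurable (X.UkH k h)) ∧ InEdgeFaces₃ 𝔊 𝔠 X := by
  classical
  -- the constraint family, empty beyond `K`
  let Adm : (k : ℕ) → Hist S.P k → GaugeField S.P k G → Set (GaugeField S.P 0 G) :=
    fun k h V => if k ≤ S.K then admB42c 𝔊 𝔠 k h (Vl k h) (Sm k h) (T k) (Bk k h) V else ∅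
  have hAdm : ∀ k, k ≤ S.K → ∀ (h : Hist S.P k) (V : GaugeField S.P k G), Adm k h V = admB42c 𝔊 𝔠 k h (Vl k h) (Sm k h) (T k) (Bk k h) V :=
    fun k hk h V => if_pos hk
  have hsel : ∀ (k : ℕ) (h : Hist S.P k), ∃ f : GaugeField S.P k G → GaugeField S.P 0 G, Measurable f ∧
      (∀ V, (∃ U ∈ Adm k h V, IsMinOn A (Adm k h V) U) → f V ∈ Adm k h V ∧ IsMinOn A (Adm k h V) (f V)) ∧
      (∀ V, ¬ (∃ U ∈ Adm k h V, IsMinOn A (Adm k h V) U) → f V = 1) := by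
    intro k h
    by_cases hk : k ≤ S.K
    · obtain ⟨f, hf1, hf2, hf3⟩ := (exists_selector_admB42c 𝔊 𝔠 k h (Vl k h) (hSm k h) (T k) (Bk k h) (hcont k hk h) (hT k h) hA).1
      refine ⟨f, hf1, fun V => ?_, fun V => ?_⟩
      · rw [hAdm k hk h V]; exact hf2 V
      · rw [hAdm k hk h V]; exact hf3 V
    · refine ⟨fun _ => 1, measurable_const, fun V hex => ?_, fun _ _ => rfl⟩
      obtain ⟨U, hU, -⟩ := hex
      simp only [Adm, if_neg hk] at hU
      exact absurd hU (Set.notMem_empty U)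
  obtain ⟨X, hav, hreg, hm, hmin, hminT, hout, houtT⟩ := exists_externalInputs_of_selectors X₀ A Adm hsel
  -- solvability from non-emptiness by compactness
  have hsolv : ∀ k, k ≤ S.K → ∀ (h : Hist S.P k), Hist.Admissible 𝔠.lane.carrier.M₁ (rcolOf S 𝔠.lane.carrier) k h →
      ∀ (V : GaugeField S.P k G), ∃ U ∈ Adm k h V, IsMinOn A (Adm k h V) U := by
    intro k hk h hh V
    rw [hAdm k hk h V]
    exact (exists_selector_admB42c 𝔊 𝔠 k h (Vl k h) (hSm k h) (T k) (Bk k h) (hcont k hk h) (hT k h) hA).2 hk V (hne k hk h hh V)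
  -- every value on the run's scales lies in the open regular class
  have hval : ∀ k, k ≤ S.K → ∀ (h : Hist S.P k) (U : GaugeField S.P k G), X.UkH k h U ∈ regClass 𝔊 𝔠 k h := by
    intro k hk h U
    by_cases hh : h = Hist.triv S.P k
    · subst hh
      rw [X.UkH_triv]
      cases k with
      | zero => exact fun j hj => absurd hj (Nat.not_lt_zero j)
      | succ k =>
        show X.Uk k U ∈ regClass 𝔊 𝔠 (k + 1) (Hist.triv S.P (k + 1))
        by_cases hex : ∃ U' ∈ Adm (k + 1) (Hist.triv S.P (k + 1)) U, IsMinOn A (Adm (k + 1) (Hist.triv S.P (k + 1)) U) U'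
        · have h1 := (hminT k U hex).1
          rw [hAdm (k + 1) hk] at h1
          exact h1.1.1
        · rw [houtT k U hex]
          exact one_mem_regClass 𝔊 𝔠 (k + 1) hk _
    · by_cases hex : ∃ U' ∈ Adm k h U, IsMinOn A (Adm k h U) U'
      · have h1 := (hmin k h U hh hex).1
        rw [hAdm k hk] at h1
        exact h1.1.1
      · rw [hout k h U hh hex]
        exact one_mem_regClass 𝔊 𝔠 k hk h
  have hreg2 : ∀ k, k ≤ S.K → ∀ (h : Hist S.P k) (U : GaugeField S.P k G), ∀ j < k,
      RegLift S j (Omega 𝔠.lane.carrier.M₁ (rcolOf S 𝔠.lane.carrier) k h j)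
        (𝔠.C68 * (S.gk j * pFun 𝔠.lane.carrier.b₀ 𝔠.lane.carrier.p₀ (S.gk j))) (liftCfg 𝔊 (X.UkH k h U)) :=
    fun k hk h U j hj => hval k hk h U j hj
  -- at admissible histories the value IS in the constraint space
  have hsolN : ∀ k, k ≤ S.K → ∀ (h : Hist S.P k), Hist.Admissible 𝔠.lane.carrier.M₁ (rcolOf S 𝔠.lane.carrier) k h →
      h ≠ Hist.triv S.P k → ∀ (U : GaugeField S.P k G), X.UkH k h U ∈ admB42c 𝔊 𝔠 k h (Vl k h) (Sm k h) (T k) (Bk k h) U := by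
    intro k hk h hh ht U
    have h1 := (hmin k h U ht (hsolv k hk h hh U)).1
    rw [hAdm k hk] at h1
    exact h1
  have hsolT : ∀ k, k + 1 ≤ S.K → Hist.Admissible 𝔠.lane.carrier.M₁ (rcolOf S 𝔠.lane.carrier) (k + 1) (Hist.triv S.P (k + 1)) →
      ∀ (U : GaugeField S.P (k + 1) G),
        X.Uk k U ∈ admB42c 𝔊 𝔠 (k + 1) (Hist.triv S.P (k + 1)) (Vl (k + 1) (Hist.triv S.P (k + 1))) (Sm (k + 1) (Hist.triv S.P (k + 1)))
            (T (k + 1)) (Bk (k + 1) (Hist.triv S.P (k + 1))) U := by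
    intro k hk hh U
    have h1 := (hminT k U (hsolv (k + 1) hk _ hh U)).1
    rw [hAdm (k + 1) hk] at h1
    exact h1
  have h42 : ∀ k, k ≤ S.K → ∀ (h : Hist S.P k), Hist.Admissible 𝔠.lane.carrier.M₁ (rcolOf S 𝔠.lane.carrier) k h →
      ∀ (U : GaugeField S.P k G), ∃ V : ℕ → B7Prop1Explicit.Site S.P.d → Fin S.P.d → (Matrix (Fin 𝔊.N) (Fin 𝔊.N) ℂ)ˣ,
        HLarge S 𝔠.lane.carrier.b₀ 𝔠.lane.carrier.p₀ h V ∧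
          InB42Lift S 𝔠.lane.carrier.M₁ (rcolOf S 𝔠.lane.carrier) h (liftCfg 𝔊 (X.UkH k h U)) V := by
    intro k hk h hh U
    refine ⟨Vl k h, hVl k hk h hh, ?_⟩
    by_cases ht : h = Hist.triv S.P k
    · subst ht
      cases k with
      | zero => exact fun j hj => absurd hj (Nat.not_lt_zero j)
      | succ k =>
        rw [X.UkH_triv]
        exact (hsolT k hk hh U).1.2.1
    · exact (hsolN k hk h hh ht U).1.2.1
  exact ⟨X, hav, hreg, hm, inEdgeFaces₃_of_inB42 𝔊 𝔠 X hm hreg2 h42⟩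

/-! ## §2 The END over the constructed profiles -/

omit [HaarData G] in
/-- **THE CONSTRAINT SPACE OF A PROFILE CONTAINS THE PROFILE** (data := its own lifted averages, no top clause): for `k ≤ K` and admissible `h` (collars
`≥ 14`), `prof ∈ admB42c 𝔊 𝔠 k h (lifted averages of prof) ∅ T Bk V` for every `V`. [cite: Balaban1985UV3, (42) p.266; Balaban1985Variational, (3)+(8) pp.278–279] -/
theorem prof_mem_admB42c {X : Matrix (Fin 𝔊.N) (Fin 𝔊.N) ℂ} (hX : X ∈ 𝔊.lie) (hX0 : X ≠ 0) {k : ℕ} (hk : k ≤ S.K) (h : Hist S.P k)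
    (hR : CollarOK S 𝔠 k) (T : GaugeField S.P 0 G → GaugeField S.P k G) (Bk : Set (PBond S.P k)) (V : GaugeField S.P k G) :
    prof S 𝔠 h hX ∈ admB42c 𝔊 𝔠 k h (fun j => avgIter L (liftCfg 𝔊 (prof S 𝔠 h hX)) j) (∅ : Set (GaugeField S.P k G)) T Bk V := by
  have hC := prof_mem_regClassC S 𝔠 h hX hX0 hk hR
  exact ⟨⟨regClassC_subset_regClass 𝔊 𝔠 hk h hC, fun _ _ _ _ _ _ => rfl, fun hV => absurd hV (Set.notMem_empty V)⟩, hC⟩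

/-- **★ `InEdgeFaces₃` FOR EXTERNAL INPUTS THAT EXIST, FROM (b7) ON [7]'S CLASS AND STRUCTURE ONLY.**  With the data := the lifted averages of the profiles of
F5 (no top clause), a continuous objective `A` and top maps `T k` continuous on [7]'s class: external inputs `X` (same `av`, `reg` as `X₀`; measurable
`U_k(·, h)`) with `InEdgeFaces₃ 𝔊 𝔠 X` EXIST, given (b7) `hcont` (`k ≤ K`) and the structural hypotheses `X ∈ 𝔤 ∖ 0`, `C68 ≥ 4π`, `C68·g_jp(g_j) ≤ ¼`,
`⌈R₁r(g_j)⌉M₁ ≥ 14` (`j < K`).  The (b11‴) hypothesis of gen 4 is discharged by F5d. [cite: Balaban1985UV3, (40)–(42) p.266 + (67)–(68) p.273; Balaban1985Variational, (2)+(3)+(8) pp.278–279] -/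
theorem exists_externalInputs_faces₃_of_structure (X₀ : ExternalInputs S G) {A : GaugeField S.P 0 G → ℝ} (hA : letI := rhoTopology 𝔊; Continuous A)
    {X : Matrix (Fin 𝔊.N) (Fin 𝔊.N) ℂ} (hX : X ∈ 𝔊.lie) (hX0 : X ≠ 0) (hC : 4 * Real.pi ≤ 𝔠.C68)
    (hsm : ∀ j, j < S.K → 𝔠.C68 * (S.gk j * pFun 𝔠.lane.carrier.b₀ 𝔠.lane.carrier.p₀ (S.gk j)) ≤ 1 / 4)
    (hRc : ∀ j, j < S.K → 14 ≤ rcolOf S 𝔠.lane.carrier j)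
    (T : (k : ℕ) → GaugeField S.P 0 G → GaugeField S.P k G) (Bk : (k : ℕ) → Hist S.P k → Set (PBond S.P k))
    (hcont : letI := rhoTopology 𝔊; ∀ (k : ℕ), k ≤ S.K → ∀ (h : Hist S.P k), ∀ j < k, ∀ (z : B7Prop1Explicit.Site S.P.d) (κ : Fin S.P.d),
      projSite (((L : ℤ) ^ j) • z) ∈ Lam 𝔠.lane.carrier.M₁ (rcolOf S 𝔠.lane.carrier) h j →
      projSite (((L : ℤ) ^ j) • (z + e κ)) ∈ Lam 𝔠.lane.carrier.M₁ (rcolOf S 𝔠.lane.carrier) h j →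
      ContinuousOn (fun U : GaugeField S.P 0 G => ((avgIter L (liftCfg 𝔊 U) j z κ : (Matrix (Fin 𝔊.N) (Fin 𝔊.N) ℂ)ˣ) :
        Matrix (Fin 𝔊.N) (Fin 𝔊.N) ℂ)) (regClass 𝔊 𝔠 k h))
    (hT : letI := rhoTopology 𝔊; ∀ (k : ℕ) (h : Hist S.P k), ContinuousOn (T k) (regClass 𝔊 𝔠 k h)) :
    ∃ Xe : ExternalInputs S G, Xe.av = X₀.av ∧ Xe.reg = X₀.reg ∧ (∀ (k : ℕ) (h : Hist S.P k), Measurable (Xe.UkH k h)) ∧ InEdgeFaces₃ 𝔊 𝔠 Xe := by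
  letI := rhoTopology 𝔊
  refine exists_externalInputs_faces₃_restricted 𝔊 𝔠 X₀ hA (fun k h j => avgIter L (liftCfg 𝔊 (prof S 𝔠 h hX)) j) ?_ (fun _ _ => ∅)
    (fun _ _ => isOpen_empty) T Bk hcont hT ?_
  · intro k hk h hh
    have hR : CollarOK S 𝔠 k := fun j hj => by have := hRc j (by omega); norm_num [R0]; omega
    exact hLarge_prof S 𝔠 h hX hX0 hk hR (fun j hj => hsm j (by omega)) hC hh
  · intro k hk h _ V
    have hR : CollarOK S 𝔠 k := fun j hj => by have := hRc j (by omega); norm_num [R0]; omega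
    exact ⟨prof S 𝔠 h hX, prof_mem_admB42c 𝔊 𝔠 hX hX0 hk h hR (T k) (Bk k h) V⟩

/-- **★ THE (α) CLAUSE FROM THE DATA SCHEMA, (b7) ON [7]'S CLASS, AND STRUCTURE** — standard external inputs, objective = a Wilson action, top map = the
iterated standard averaging: external inputs `Xe` EXIST (`InEdgeFaces₃ 𝔊 (regMin 𝔠) Xe`, measurable `U_k(·, h)`) such that for every `𝔖, 𝔄, coef` the DATA
schema on the N08 family gives `RunAlpha 𝔊 𝔠 Xe 𝔖 𝔄`.  Displayed: (b7) `hcont` on [7]'s class at print's single regularity constant `regMin 𝔠` (`k ≤ K`);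
structural: `X ∈ 𝔤 ∖ 0`, `min C68 (2L²B₃) ≥ 4π`, `min C68 (2L²B₃)·g_jp(g_j) ≤ ¼` and `⌈R₁r(g_j)⌉M₁ ≥ 14` for `j < K`.  No (b11) hypothesis remains.
[cite: Balaban1985UV3, (41)–(42) p.266 + (44) p.267 + (67)–(68) p.273; Balaban1985Variational, (2)+(3)+(8) pp.278–279; Balaban1985Averaging, (42)–(43) pp.23–24] -/
theorem exists_externalInputs_runAlpha_of_structure (X₀ : ExternalInputs S G) (hstd : X₀.av = AveragingRT.stdAvg S.P G) (w : ℝ)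
    {X : Matrix (Fin 𝔊.N) (Fin 𝔊.N) ℂ} (hX : X ∈ 𝔊.lie) (hX0 : X ≠ 0) (hC : 4 * Real.pi ≤ (regMin 𝔠).C68)
    (hsm : ∀ j, j < S.K → (regMin 𝔠).C68 * (S.gk j * pFun 𝔠.lane.carrier.b₀ 𝔠.lane.carrier.p₀ (S.gk j)) ≤ 1 / 4)
    (hRc : ∀ j, j < S.K → 14 ≤ rcolOf S 𝔠.lane.carrier j) (Bk : (k : ℕ) → Hist S.P k → Set (PBond S.P k))
    (hcont : letI := rhoTopology 𝔊; ∀ (k : ℕ), k ≤ S.K → ∀ (h : Hist S.P k), ∀ j < k, ∀ (z : B7Prop1Explicit.Site S.P.d) (κ : Fin S.P.d),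
      projSite (((L : ℤ) ^ j) • z) ∈ Lam (regMin 𝔠).lane.carrier.M₁ (rcolOf S (regMin 𝔠).lane.carrier) h j →
      projSite (((L : ℤ) ^ j) • (z + e κ)) ∈ Lam (regMin 𝔠).lane.carrier.M₁ (rcolOf S (regMin 𝔠).lane.carrier) h j →
      ContinuousOn (fun U : GaugeField S.P 0 G => ((avgIter L (liftCfg 𝔊 U) j z κ : (Matrix (Fin 𝔊.N) (Fin 𝔊.N) ℂ)ˣ) :
        Matrix (Fin 𝔊.N) (Fin 𝔊.N) ℂ)) (regClass 𝔊 (regMin 𝔠) k h)) :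
    ∃ Xe : ExternalInputs S G, Xe.av = AveragingRT.stdAvg S.P G ∧ Xe.reg = X₀.reg ∧ (∀ (k : ℕ) (h : Hist S.P k), Measurable (Xe.UkH k h)) ∧
      InEdgeFaces₃ 𝔊 (regMin 𝔠) Xe ∧
      ∀ (𝔖 : ∀ k, StepSeries S G ↥(lieC 𝔊) (nblkOf S 𝔠.lane.carrier k) k) (𝔄 : AlphaData 𝔊 𝔠 Xe 𝔖)
        (coef : (k : ℕ) → Hist S.P (k + 1) → GaugeField S.P (k + 1) G → (j : ℕ) → TermSizes (oldGeom S.P k j)),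
        S.g ^ 2 * S.ε₀ ≤ (min (gammaN08 𝔠) 1) ^ 2 → RunDataRows 𝔊 𝔠 Xe 𝔖 𝔄 (sizesOf 𝔊 𝔠 Xe coef) → RunAlpha 𝔊 𝔠 Xe 𝔖 𝔄 := by
  letI := rhoTopology 𝔊
  haveI := continuousMul_rho 𝔊
  haveI := continuousInv_rho 𝔊
  have hA : Continuous (wilsonAction w : GaugeField S.P 0 G → ℝ) := continuous_wilsonAction (continuous_reTr_rho 𝔊) w
  have hT : ∀ (k : ℕ) (h : Hist S.P k), ContinuousOn (Averaging.iter X₀.av k) (regClass 𝔊 (regMin 𝔠) k h) := fun k h => by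
    refine Continuous.continuousOn ?_
    rw [hstd]
    exact continuous_iter (fun j => continuous_stdAvg j) k
  obtain ⟨Xe, hav, hreg, hm, F⟩ := exists_externalInputs_faces₃_of_structure 𝔊 (regMin 𝔠) X₀ hA hX hX0 hC hsm hRc
    (fun k => Averaging.iter X₀.av k) Bk hcont hT
  exact ⟨Xe, hav.trans hstd, hreg, hm, F, fun 𝔖 𝔄 coef hle D => runAlpha_of_data_faces₃_of_le 𝔊 𝔠 Xe 𝔖 𝔄 coef hle D F⟩

/-! ## §3 The END with (b7) discharged by [4] Proposition 2 (F6): the in-edge side of the (α) clause is EMPTY -/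

/-- **★★ THE (α) CLAUSE FROM THE DATA SCHEMA AND STRUCTURE ALONE.**  Standard external inputs, objective = a Wilson action, top map = the iterated standard
averaging, data = the lifted averages of the constructed profiles; (b7) supplied by F6's `hcont_regClass` ([4] Prop. 2 with its printed locality, on [7]'s class).
External inputs `Xe` EXIST (`InEdgeFaces₃ 𝔊 (regMin 𝔠) Xe`, measurable `U_k(·, h)`) such that for every `𝔖, 𝔄, coef` the DATA schema on the N08 family gives
`RunAlpha 𝔊 𝔠 Xe 𝔖 𝔄`.  Hypotheses, all STRUCTURAL (`α_j := min C68 (2L²B₃)·g_jp(g_j)`, `j < K`): `X ∈ 𝔤 ∖ 0`; `min C68 (2L²B₃) ≥ 4π`; `α_j ≤ ¼`;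
[4]'s window `C₀(d)α_j ≤ ⅓`, `2α_j ≤ c₂′(d, L)`, `512(d+1)(d+4)L²(α_j + 2C₀α_j²) ≤ 1`; collars `⌈R₁r(g_j)⌉M₁ ≥ 14`.  NO in-edge hypothesis ((b7), (b11)) remains.
[cite: Balaban1985UV3, (41)–(42) p.266 + (44) p.267 + (67)–(68) p.273; Balaban1985Variational, (2)+(3)+(8) pp.278–279; Balaban1985Averaging, Prop. 2 (54) p.26 + (42)–(43) pp.23–24] -/
theorem exists_externalInputs_runAlpha_of_structure_window (X₀ : ExternalInputs S G) (hstd : X₀.av = AveragingRT.stdAvg S.P G) (w : ℝ)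
    {X : Matrix (Fin 𝔊.N) (Fin 𝔊.N) ℂ} (hX : X ∈ 𝔊.lie) (hX0 : X ≠ 0) (hC : 4 * Real.pi ≤ (regMin 𝔠).C68)
    (hsm : ∀ j, j < S.K → (regMin 𝔠).C68 * (S.gk j * pFun 𝔠.lane.carrier.b₀ 𝔠.lane.carrier.p₀ (S.gk j)) ≤ 1 / 4)
    (hα3 : ∀ j, j < S.K → C0 S.P.d * ((regMin 𝔠).C68 * (S.gk j * pFun 𝔠.lane.carrier.b₀ 𝔠.lane.carrier.p₀ (S.gk j))) ≤ 1 / 3)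
    (hα2 : ∀ j, j < S.K → 2 * ((regMin 𝔠).C68 * (S.gk j * pFun 𝔠.lane.carrier.b₀ 𝔠.lane.carrier.p₀ (S.gk j))) ≤ c2' S.P.d L)
    (hwin : ∀ j, j < S.K → 512 * ((S.P.d : ℝ) + 1) * (S.P.d + 4) * (L : ℝ) ^ 2 *
      (((regMin 𝔠).C68 * (S.gk j * pFun 𝔠.lane.carrier.b₀ 𝔠.lane.carrier.p₀ (S.gk j))) +
        2 * C0 S.P.d * ((regMin 𝔠).C68 * (S.gk j * pFun 𝔠.lane.carrier.b₀ 𝔠.lane.carrier.p₀ (S.gk j))) ^ 2) ≤ 1)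
    (hRc : ∀ j, j < S.K → 14 ≤ rcolOf S 𝔠.lane.carrier j) (Bk : (k : ℕ) → Hist S.P k → Set (PBond S.P k)) :
    ∃ Xe : ExternalInputs S G, Xe.av = AveragingRT.stdAvg S.P G ∧ Xe.reg = X₀.reg ∧ (∀ (k : ℕ) (h : Hist S.P k), Measurable (Xe.UkH k h)) ∧
      InEdgeFaces₃ 𝔊 (regMin 𝔠) Xe ∧
      ∀ (𝔖 : ∀ k, StepSeries S G ↥(lieC 𝔊) (nblkOf S 𝔠.lane.carrier k) k) (𝔄 : AlphaData 𝔊 𝔠 Xe 𝔖)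
        (coef : (k : ℕ) → Hist S.P (k + 1) → GaugeField S.P (k + 1) G → (j : ℕ) → TermSizes (oldGeom S.P k j)),
        S.g ^ 2 * S.ε₀ ≤ (min (gammaN08 𝔠) 1) ^ 2 → RunDataRows 𝔊 𝔠 Xe 𝔖 𝔄 (sizesOf 𝔊 𝔠 Xe coef) → RunAlpha 𝔊 𝔠 Xe 𝔖 𝔄 := by
  have hL2 : 2 ≤ L := S.hL.2
  exact exists_externalInputs_runAlpha_of_structure 𝔊 𝔠 X₀ hstd w hX hX0 hC hsm hRc Bk (hcont_regClass 𝔊 (regMin 𝔠) hL2 hα3 hα2 hwin)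

end Summit.QuantumFields.YangMills.Theorems.BalabanUVNodesN08AlphaProfileEnd

end
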